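import Summits.Ventures.CertifiedManyBodySolver.Downfold.EmeryHybridisationSubquadratic
import Summits.Ventures.CertifiedManyBodySolver.Downfold.EmeryChargeTransferShapeLever
import HarnessLib

/-!
# THE HYBRIDISATION LEVER OF THE FERMI-SURFACE SHAPE AT FIXED DOPING: a larger `t_pd` makes the one-band `t′/t` of the σ row LESS negative —
# monotone, certificate-free, from the sub-quadratic `t_pd` law

Venture CertifiedManyBodySolver, cell `pub/hubbard-downfold` (stage S1; INFLATION-RULES-3to1-B §B.85 (e)–(g)), seat hubbard-downfold-mod-4 (technique B = band
level, g35); namespace `Summit.Ventures.CertifiedManyBodySolver.Downfold.Emery`. Everything PROVED (0 sorry, no definition). WHAT THIS IS NOT: a statement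
about any material; `U = 0` one-body kinematics of the σ (d–p_x–p_y + t_pp, t_pp′) model; no number lives here.

THE QUESTION (INFL-3to1-B for object E, second coordinate direction). By the contour theorem the Fermi surface of a σ row at filling `ν` IS a `t–t′` Fermi
surface with `t′/t = fsRatio(θ; ε_F) = −N/(D + 2N)`, `D = (Δ + ε_F)(t_pd² − t_pp′ε_F)`, `N = 2t_pd²(t_pp + t_pp′) + ε_F(t_pp² − t_pp′²)`. `EmeryChargeTransferShapeLever`
(§B.83 (g)) signed the `Δ` direction. In `t_pd` two effects compete: `D` and `N` both grow like `t_pd²` explicitly, and the Fermi energy of the doping RISES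
(`fermiEnergyOf_mono_tpdSq`) — which enters `D` with a positive and `N` with a positive coefficient. The sub-quadratic law `ε_F(μt_pd) ≤ μ²ε_F(t_pd)`
(`EmeryHybridisationSubquadratic`) is exactly what closes the comparison:

* §1 `negRatio_le_of_cross`: `−N₁/(D₁ + 2N₁) ≤ −N₂/(D₂ + 2N₂)` iff-direction `N₂D₁ ≤ N₁D₂` (`N₁, N₂ > 0`, `D₁, D₂ ≥ 0`): the shape is a function of `D/N`.
* §2 **THE LEVER** (`fsRatio_fermiEnergyOf_mono_tpd`): for `μ ≥ 1`, `Δ > 0`, `t_pd > 0`, `t_pp > 0`, `0 ≤ t_pp′ ≤ t_pp`, `0 < ν < 1` and the sheet regime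
  `t_pp′·ε_F(t_pd; ν) ≤ t_pd²` at the SMALLER hybridisation: **`fsRatio(t_pd; ε_F(t_pd; ν)) ≤ fsRatio(μt_pd; ε_F(μt_pd; ν))`** — AT FIXED DOPING, RAISING THE Cu–O
  HYBRIDISATION MAKES `t′/t` LESS NEGATIVE. Mechanism (no calculus): with `E ≤ E′ ≤ μ²E`, `N′ ≤ μ²N` (`E′ ≤ μ²E`, `t_pp² ≥ t_pp′²`) while `D′ ≥ μ²D`
  (`Δ + E′ ≥ Δ + E` and `μ²t_pd² − t_pp′E′ ≥ μ²(t_pd² − t_pp′E)`), so `N′D ≤ μ²ND ≤ ND′`. The regime propagates upward (`sheetRegime_mono_tpd`: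
  `t_pp′ε_F(t_pd) ≤ t_pd² ⇒ t_pp′ε_F(μt_pd) ≤ (μt_pd)²`). General form `fsRatio_fermiEnergyOf_mono_tpd'` for `0 < t_pd ≤ t_pd′`.
* §3 BOX FORM (`fsRatio_fermiEnergyOf_mem_Icc_of_tpd_mem`): on a typed box whose only width is `t_pd ∈ [a₁, a₂]` the fixed-doping `t′/t` of every member lies
  between the two ENDPOINT values — a two-corner rule for object E in the `t_pd` direction (regime checked once, at `a₁`).
* §4 CONSISTENCY WITH THE SCALING LAW (remark, no new theorem): by `fsRatio_fermiEnergyOf_eq_ratios` (§B.84) the shape depends on `(Δ/t_pd, t_pp/t_pd, t_pp′/t_pd)`;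
  raising `t_pd` lowers all three ratios, and the lever says the net effect is `t′/t ↑` — the Δ-lever (`Δ/t_pd ↓ ⇒ t′/t ↓`) is therefore BEATEN by the
  oxygen ratios (`t_pp/t_pd, t_pp′/t_pd ↓ ⇒ t′/t ↑`): the oxygen–oxygen channel, not the charge-transfer energy, controls the shape (§B.85 (h),
  `EmeryOxygenRayShapeLever`).

Sources: three-band model [HybertsenSchluterChristensen1989, Eq. (1)]; contour form [AndersenEtAl1995, §6]; arithmetic [folklore].
-/

noncomputable section

namespace Summit.Ventures.CertifiedManyBodySolver.Downfold.Emery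

open Real Set

/-! ## §1 The shape is a function of `D/N` -/

/-- `−N₁/(D₁ + 2N₁) ≤ −N₂/(D₂ + 2N₂)` as soon as `N₂D₁ ≤ N₁D₂` (`N₁, N₂ > 0`, `D₁, D₂ ≥ 0`). [folklore] -/
theorem negRatio_le_of_cross {N₁ N₂ D₁ D₂ : ℝ} (hN₁ : 0 < N₁) (hN₂ : 0 < N₂) (hD₁ : 0 ≤ D₁) (hD₂ : 0 ≤ D₂) (h : N₂ * D₁ ≤ N₁ * D₂) :
    -N₁ / (D₁ + 2 * N₁) ≤ -N₂ / (D₂ + 2 * N₂) := by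
  have h1 : 0 < D₁ + 2 * N₁ := by linarith
  have h2 : 0 < D₂ + 2 * N₂ := by linarith
  rw [neg_div, neg_div, neg_le_neg_iff, div_le_div_iff₀ h2 h1]
  nlinarith

/-! ## §2 The lever -/

section Lever

variable {Δ a b c μ ν : ℝ}

/-- The sheet regime propagates to larger hybridisation: `t_pp′·ε_F(t_pd) ≤ t_pd² ⇒ t_pp′·ε_F(μt_pd) ≤ (μt_pd)²` (`μ ≥ 1`, certificate-free). [folklore] -/
theorem sheetRegime_mono_tpd (hΔ : 0 < Δ) (ha : a ≠ 0) (hc : 0 ≤ c) (hb : 0 ≤ b) (hμ : 1 ≤ μ) (hν0 : 0 < ν) (hν1 : ν < 1)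
    (hreg : c * fermiEnergyOf Δ a b c ν ≤ a ^ 2) : c * fermiEnergyOf Δ (μ * a) b c ν ≤ (μ * a) ^ 2 := by
  have h := fermiEnergyOf_tpd_le_sq_mul' hΔ ha hc hb hμ hν0 hν1
  calc c * fermiEnergyOf Δ (μ * a) b c ν ≤ c * (μ ^ 2 * fermiEnergyOf Δ a b c ν) := mul_le_mul_of_nonneg_left h hc
    _ = μ ^ 2 * (c * fermiEnergyOf Δ a b c ν) := by ring
    _ ≤ μ ^ 2 * a ^ 2 := mul_le_mul_of_nonneg_left hreg (sq_nonneg μ)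
    _ = (μ * a) ^ 2 := by ring

/-- **AT FIXED DOPING, RAISING `t_pd` MAKES THE FERMI-SURFACE `t′/t` LESS NEGATIVE** (`μ ≥ 1`; sheet regime at the smaller `t_pd`). [folklore] -/
theorem fsRatio_fermiEnergyOf_mono_tpd (hΔ : 0 < Δ) (ha : 0 < a) (hb : 0 < b) (hc : 0 ≤ c) (hcb : c ≤ b) (hμ : 1 ≤ μ)
    (hν0 : 0 < ν) (hν1 : ν < 1) (hreg : c * fermiEnergyOf Δ a b c ν ≤ a ^ 2) :
    fsRatio Δ a b c (fermiEnergyOf Δ a b c ν) ≤ fsRatio Δ (μ * a) b c (fermiEnergyOf Δ (μ * a) b c ν) := by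
  set E := fermiEnergyOf Δ a b c ν with hE
  set E' := fermiEnergyOf Δ (μ * a) b c ν with hE'
  have hbr := fermiEnergyOf_tpd_mem_Icc (b := b) hΔ ha.ne' hc hb.le hμ hν0 hν1
  rw [← hE, ← hE'] at hbr
  obtain ⟨hlo, hhi⟩ := hbr
  have hE0 : 0 < E := fermiEnergyOf_pos hΔ ha.ne' hc hb.le hν0 hν1
  have hμ0 : 0 < μ := by linarith
  have hμ2 : 1 ≤ μ ^ 2 := by nlinarith
  have ha2 : 0 < a ^ 2 := by positivity
  have hbc : 0 ≤ b ^ 2 - c ^ 2 := by nlinarith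
  -- the four weights
  have hN : 0 < fsN a b c E := by
    unfold fsN
    have : 0 < 2 * a ^ 2 * (c + b) := by positivity
    nlinarith
  have hN' : 0 < fsN (μ * a) b c E' := by
    unfold fsN
    have : 0 < 2 * (μ * a) ^ 2 * (c + b) := by positivity
    nlinarith
  have hDnn : 0 ≤ fsD Δ a c E := by
    unfold fsD; exact mul_nonneg (by linarith) (by linarith)
  have hreg' : c * E' ≤ (μ * a) ^ 2 := sheetRegime_mono_tpd hΔ ha.ne' hc hb.le hμ hν0 hν1 hreg
  have hD'nn : 0 ≤ fsD Δ (μ * a) c E' := by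
    unfold fsD; exact mul_nonneg (by linarith) (by linarith)
  -- N′ ≤ μ²N
  have hNN : fsN (μ * a) b c E' ≤ μ ^ 2 * fsN a b c E := by
    unfold fsN
    have h1 : E' * (b ^ 2 - c ^ 2) ≤ μ ^ 2 * E * (b ^ 2 - c ^ 2) := mul_le_mul_of_nonneg_right hhi hbc
    nlinarith
  -- D′ ≥ μ²D
  have hDD : μ ^ 2 * fsD Δ a c E ≤ fsD Δ (μ * a) c E' := by
    unfold fsD
    have h1 : Δ + E ≤ Δ + E' := by linarith
    have h2 : μ ^ 2 * (a ^ 2 - c * E) ≤ (μ * a) ^ 2 - c * E' := by nlinarith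
    have h3 : 0 ≤ μ ^ 2 * (a ^ 2 - c * E) := mul_nonneg (sq_nonneg μ) (by linarith)
    calc μ ^ 2 * ((Δ + E) * (a ^ 2 - c * E)) = (Δ + E) * (μ ^ 2 * (a ^ 2 - c * E)) := by ring
      _ ≤ (Δ + E') * (μ ^ 2 * (a ^ 2 - c * E)) := mul_le_mul_of_nonneg_right h1 h3
      _ ≤ (Δ + E') * ((μ * a) ^ 2 - c * E') := mul_le_mul_of_nonneg_left h2 (by linarith)
  -- cross
  have hcross : fsN (μ * a) b c E' * fsD Δ a c E ≤ fsN a b c E * fsD Δ (μ * a) c E' :=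
    calc fsN (μ * a) b c E' * fsD Δ a c E ≤ μ ^ 2 * fsN a b c E * fsD Δ a c E := mul_le_mul_of_nonneg_right hNN hDnn
      _ = fsN a b c E * (μ ^ 2 * fsD Δ a c E) := by ring
      _ ≤ fsN a b c E * fsD Δ (μ * a) c E' := mul_le_mul_of_nonneg_left hDD hN.le
  unfold fsRatio
  exact negRatio_le_of_cross hN hN' hDnn hD'nn hcross

/-- General form: for `0 < t_pd ≤ t_pd′` (sheet regime at `t_pd`), `fsRatio(t_pd; ε_F(t_pd)) ≤ fsRatio(t_pd′; ε_F(t_pd′))`. [folklore] -/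
theorem fsRatio_fermiEnergyOf_mono_tpd' {a' : ℝ} (hΔ : 0 < Δ) (ha : 0 < a) (haa : a ≤ a') (hb : 0 < b) (hc : 0 ≤ c) (hcb : c ≤ b)
    (hν0 : 0 < ν) (hν1 : ν < 1) (hreg : c * fermiEnergyOf Δ a b c ν ≤ a ^ 2) :
    fsRatio Δ a b c (fermiEnergyOf Δ a b c ν) ≤ fsRatio Δ a' b c (fermiEnergyOf Δ a' b c ν) := by
  have hμ : 1 ≤ a' / a := by rw [le_div_iff₀ ha]; linarith
  have h := fsRatio_fermiEnergyOf_mono_tpd (μ := a' / a) hΔ ha hb hc hcb hμ hν0 hν1 hreg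
  rwa [div_mul_cancel₀ _ ha.ne'] at h

/-- The regime propagates upward in the general form: `t_pp′·ε_F(t_pd) ≤ t_pd²`, `t_pd ≤ t_pd′` ⇒ `t_pp′·ε_F(t_pd′) ≤ t_pd′²`. [folklore] -/
theorem sheetRegime_mono_tpd' {a' : ℝ} (hΔ : 0 < Δ) (ha : 0 < a) (haa : a ≤ a') (hc : 0 ≤ c) (hb : 0 ≤ b) (hν0 : 0 < ν) (hν1 : ν < 1)
    (hreg : c * fermiEnergyOf Δ a b c ν ≤ a ^ 2) : c * fermiEnergyOf Δ a' b c ν ≤ a' ^ 2 := by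
  have hμ : 1 ≤ a' / a := by rw [le_div_iff₀ ha]; linarith
  have h := sheetRegime_mono_tpd (μ := a' / a) hΔ ha.ne' hc hb hμ hν0 hν1 hreg
  rwa [div_mul_cancel₀ _ ha.ne'] at h

end Lever

/-! ## §3 Box form: the `t_pd`-endpoints bound the fixed-doping shape -/

/-- **TWO-CORNER RULE IN `t_pd` FOR OBJECT E**: for `a₁ ≤ t_pd ≤ a₂` (all else fixed; sheet regime at `a₁`), the fixed-doping `t′/t` at `t_pd` lies between its
values at `a₁` and `a₂`. [folklore] -/
theorem fsRatio_fermiEnergyOf_mem_Icc_of_tpd_mem {Δ a b c a₁ a₂ ν : ℝ} (hΔ : 0 < Δ) (ha₁ : 0 < a₁) (h1 : a₁ ≤ a) (h2 : a ≤ a₂) (hb : 0 < b)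
    (hc : 0 ≤ c) (hcb : c ≤ b) (hν0 : 0 < ν) (hν1 : ν < 1) (hreg₁ : c * fermiEnergyOf Δ a₁ b c ν ≤ a₁ ^ 2) :
    fsRatio Δ a b c (fermiEnergyOf Δ a b c ν) ∈
      Icc (fsRatio Δ a₁ b c (fermiEnergyOf Δ a₁ b c ν)) (fsRatio Δ a₂ b c (fermiEnergyOf Δ a₂ b c ν)) := by
  have ha : 0 < a := lt_of_lt_of_le ha₁ h1
  exact ⟨fsRatio_fermiEnergyOf_mono_tpd' hΔ ha₁ h1 hb hc hcb hν0 hν1 hreg₁,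
    fsRatio_fermiEnergyOf_mono_tpd' hΔ ha h2 hb hc hcb hν0 hν1 (sheetRegime_mono_tpd' hΔ ha₁ h1 hc hb.le hν0 hν1 hreg₁)⟩

end Summit.Ventures.CertifiedManyBodySolver.Downfold.Emery
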